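import Summits.AtomisticToContinuum.BoseEinsteinCondensation.Theorems.BECHardSphereReductionHardCoreDominatesOfDiniSign

/-!
# Planner hand-off (lead c3, crux stmt-AtomisticToContinuum-11884 `HardCoreDominates`): ready-to-file statements + checked glue

Not a proposal. Three statements the `promote-stub` recommendation refers to, written over tree vocabulary and elaborated here,
with the glue that connects them to the crux kernel-checked in this file:

* `FiniteCouplingDomination` — the integrated residue of line `birth` (adding the bounded bump `t·1_{Iic R}` never raises the
  ground-state condensate number, in a `t`-uniform dilute window). `HardCoreDominates` follows in one line from the LANDED
  `hardCoreDominates_of_pathDominated` (p157832).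
* `DiniSign` — the registered stub `stub_diniSign` verbatim (the infinitesimal form). `HardCoreDominates` follows from the LANDED
  `hardCoreDominates_of_diniSign` (p157832).
* `HardCoreDominatesFixedN` — the fixed-`N` (box → ∞) special case recommended as rank-9 support (strategist D-3, c1, c2, c3), and
  `HardCoreDominatesEventually` — its large-`N` complement; `hardCoreDominates_of_fixedN_of_eventually` is the finite-minimum glue
  (the window is antitone in `η₀`, so `η₀ := min η' (min_{N < N₀} η_N)` works).
-/

namespace Summit.AtomisticToContinuum.BoseEinsteinCondensation.Cruxes.HardCoreDominates.Birth.Handoff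

open Literature.MathematicalPhysics.QuantumManyBody.BoseGas
open scoped ENNReal NNReal

/-- Finite-coupling domination (integrated residue of line `birth`). -/
def FiniteCouplingDomination : Prop :=
  ∀ (v : ℝ → ENNReal) (R : ℝ), Measurable v → 0 < R → (∀ r : ℝ, R < r → v r = 0) →
    ∃ η₀ : ℝ, 0 < η₀ ∧ ∀ (N : ℕ) (L : ℝ), (N : ℝ) * R ^ 3 ≤ η₀ * L ^ 3 → ∀ t : NNReal,
      condensateNumber (v + Set.indicator (Set.Iic R) (fun _ : ℝ => (t : ENNReal))) N L ≤ condensateNumber v N L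

/-- The registered stub `stub_diniSign`, verbatim. -/
def DiniSign : Prop :=
  ∀ (v : ℝ → ENNReal) (R : ℝ), Measurable v → 0 < R → (∀ r : ℝ, R < r → v r = 0) →
    ∃ η₀ : ℝ, 0 < η₀ ∧ ∀ (N : ℕ) (L : ℝ), (N : ℝ) * R ^ 3 ≤ η₀ * L ^ 3 →
      ∀ (t : NNReal) (ε : NNReal), 0 < ε → ∃ h₀ : NNReal, 0 < h₀ ∧ ∀ h : NNReal, 0 < h → h ≤ h₀ →
        condensateNumber (v + Set.indicator (Set.Iic R) (fun _ : ℝ => (((t + h : NNReal)) : ENNReal))) N L ≤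
          condensateNumber (v + Set.indicator (Set.Iic R) (fun _ : ℝ => (t : ENNReal))) N L + ((ε * h : NNReal) : ENNReal)

/-- Fixed-`N` hard-core domination (the box grows at fixed particle number): few-body finite-volume scattering theory. -/
def HardCoreDominatesFixedN : Prop :=
  ∀ (v : ℝ → ENNReal) (R : ℝ), Measurable v → 0 < R → (∀ r : ℝ, R < r → v r = 0) → ∀ N : ℕ,
    ∃ η₀ : ℝ, 0 < η₀ ∧ ∀ L : ℝ, (N : ℝ) * R ^ 3 ≤ η₀ * L ^ 3 →
      condensateNumber (Set.indicator (Set.Iic R) (fun _ : ℝ => (⊤ : ENNReal))) N L ≤ condensateNumber v N L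

/-- Large-`N` hard-core domination (the thermodynamic corner and everything above some `N₀`). -/
def HardCoreDominatesEventually : Prop :=
  ∀ (v : ℝ → ENNReal) (R : ℝ), Measurable v → 0 < R → (∀ r : ℝ, R < r → v r = 0) →
    ∃ N₀ : ℕ, ∃ η₀ : ℝ, 0 < η₀ ∧ ∀ N : ℕ, N₀ ≤ N → ∀ L : ℝ, (N : ℝ) * R ^ 3 ≤ η₀ * L ^ 3 →
      condensateNumber (Set.indicator (Set.Iic R) (fun _ : ℝ => (⊤ : ENNReal))) N L ≤ condensateNumber v N L

/-- Glue 1: finite-coupling domination ⇒ the crux (one line over p157832). -/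
theorem hardCoreDominates_of_finiteCouplingDomination (h : FiniteCouplingDomination) :
    Summit.AtomisticToContinuum.BoseEinsteinCondensation.Theses.BECHardSphereReduction.HardCoreDominates :=
  hardCoreDominates_of_pathDominated h

/-- Glue 2: the Dini-form stub ⇒ the crux (one line over p157832). -/
theorem hardCoreDominates_of_diniSign' (h : DiniSign) :
    Summit.AtomisticToContinuum.BoseEinsteinCondensation.Theses.BECHardSphereReduction.HardCoreDominates :=
  hardCoreDominates_of_diniSign h

/-- The window is antitone in `η₀` (for `0 ≤ R`): a smaller `η₀` admits fewer `L`. -/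
theorem window_mono {N : ℕ} {R L η η' : ℝ} (hR : 0 ≤ R) (hη : 0 < η) (hle : η ≤ η')
    (h : (N : ℝ) * R ^ 3 ≤ η * L ^ 3) : (N : ℝ) * R ^ 3 ≤ η' * L ^ 3 := by
  have hL : 0 ≤ L ^ 3 := by
    by_contra hneg
    push Not at hneg
    have h1 : η * L ^ 3 < 0 := mul_neg_of_pos_of_neg hη hneg
    have h2 : (0 : ℝ) ≤ (N : ℝ) * R ^ 3 := by positivity
    linarith
  exact h.trans (mul_le_mul_of_nonneg_right hle hL)

/-- Glue 3: fixed-`N` domination for every `N` plus eventual domination ⇒ the crux, by a finite minimum of windows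
(`η₀ := min η' (min_{N ≤ N₀} η_N)`). -/
theorem hardCoreDominates_of_fixedN_of_eventually (hF : HardCoreDominatesFixedN) (hE : HardCoreDominatesEventually) :
    Summit.AtomisticToContinuum.BoseEinsteinCondensation.Theses.BECHardSphereReduction.HardCoreDominates := by
  intro v R hmeas hR hvR
  obtain ⟨N₀, η', hη', hev⟩ := hE v R hmeas hR hvR
  choose η hηpos hfix using fun N => hF v R hmeas hR hvR N
  have hne : (Finset.range (N₀ + 1)).Nonempty := ⟨0, by simp⟩
  set ηmin : ℝ := (Finset.range (N₀ + 1)).inf' hne η with hηmin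
  have hηmin_pos : 0 < ηmin := by
    rw [hηmin, Finset.lt_inf'_iff]
    exact fun N _ => hηpos N
  refine ⟨min η' ηmin, lt_min hη' hηmin_pos, fun N L hNL => ?_⟩
  rcases le_or_gt N₀ N with hN | hN
  · exact hev N hN L (window_mono hR.le (lt_min hη' hηmin_pos) (min_le_left _ _) hNL)
  · have hmem : N ∈ Finset.range (N₀ + 1) := Finset.mem_range.2 (by omega)
    have hle : min η' ηmin ≤ η N := (min_le_right _ _).trans (Finset.inf'_le η hmem)
    exact hfix N L (window_mono hR.le (lt_min hη' hηmin_pos) hle hNL)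

end Summit.AtomisticToContinuum.BoseEinsteinCondensation.Cruxes.HardCoreDominates.Birth.Handoff
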